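import Mathlib
import HarnessLib
import Literature.Analysis.FluidPDE.ClassicalSolution
import Literature.Analysis.FluidPDE.SelfSimilar
import Literature.Analysis.FluidPDE.AxisymmetricEuler
import Literature.Analysis.FluidPDE.AxisymmetricVorticityTransport
import Literature.Analysis.FluidPDE.IsometryInvariance
import Literature.Analysis.FluidPDE.MildSolutionIsometryCovariance
import Literature.Analysis.FluidPDE.OseenMildUniqueness
import Literature.Analysis.FluidPDE.ParasiticSlabFlow
import Summits.NavierStokesRegularity.NavierStokesRegularity.Theorems.LocalSineTubeDoorProfileAlignedWindowRigidityAncient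
import Summits.NavierStokesRegularity.NavierStokesRegularity.Theorems.QuantisedSymmetryPolyhedralDssProfileExistsStubAncientMildOfClassicalTypeI
import Summits.NavierStokesRegularity.NavierStokesRegularity.Theorems.StableStrataDoorOneSliceDefs

/-!
# StableStrataDoorOneSliceAxiPropagation — SEED-26 input **I2b `OneSliceAxiPropagation` PROVED** (door S26
«StableStrataDoor», sequential ε-door T-axi-seq; nsreg-p1 g21 ADDENDUM-25A; text =
`StableStrataDoorOneSliceDefs.OneSliceAxiPropagation` VERBATIM)

`oneSliceAxiPropagation_holds A D : OneSliceAxiPropagation A D` for EVERY axis isometry `A` and EVERY decay constant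
`D`: a classical Type-I(`D`) solution `(V, q)` of Navier–Stokes (`ν = 1`, `f = 0`) on `(−∞,0) × ℝ³` that is
axisymmetric about the axis `A e₃` at ONE time `s₀ < 0` is axisymmetric about `A e₃` at EVERY time `τ < 0`.

PROOF.  The heart is a ONE-SLICE UNIQUENESS THEOREM in the Oseen-ancient class (continuous on the open slab,
bounded on every sub-slab `(−∞,−δ)`, Oseen–Duhamel identity between any two negative times):
`eq_of_eq_slice` — two such fields that agree at one time `s < 0` agree at all times `t < 0`.
* FORWARD (`eq_forward`, `s ≤ t < 0`): both fields solve the same Oseen integral equation from the common slice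
  on every window `(s, T₂)`, `T₂ < 0`, where they are bounded; bounded Oseen-mild solutions are unique
  (tree `oseenMild_bounded_unique`, Kato / Giga–Inui–Matsui), and continuous slices a.e. equal coincide.
* BACKWARD (`eq_backward`, `t < s`): both fields are jointly real-analytic on `(−∞,0) × ℝ³` (tree
  `LocalSineTubeDoorProfileAlignedWindowRigidityAncient.analyticOnNhd_uncurry` — Lemarié-Rieusset 2016 Thm 9.12 /
  Dong–Zhang-type time analyticity of bounded mild solutions), so `τ ↦ V(τ,y) − W(τ,y)` is real-analytic on the
  connected interval `(−∞,0)` and vanishes on `(s,0)`, hence everywhere (identity theorem; Masuda 1967's move).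
A classical Type-I(`D`) solution on the past is Oseen-ancient (`oseenAncient_of_classical_typeI`: the KNSS mild
gauge `mild_eq_of_classical_typeI` + the time rate), and so is its conjugate `V^L(t,x) = L V(t, L⁻¹x)` by any linear
isometry `L` (Majda–Bertozzi Prop. 1.1 (iii), tree `IsClassicalNSSolutionOn.conj_linearIsometryEquiv`).  With
`L = A ∘ R_θ ∘ A⁻¹`, axisymmetry about `A e₃` at time `s₀` says exactly `V^L(s₀) = V(s₀)`; one-slice uniqueness gives
`V^L = V` at every negative time, i.e. axisymmetry at every time.

Door family of LADDER-NS N0 (door S26 / SEED-26; `--supports stmt-NavierStokesRegularity-0056`, helper lane; nsreg-p6 g14).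
WHAT THIS IS NOT: not NS regularity (Clay A); no route, no item; I2b is one of three typed inputs (I1, I2a, I2b) of the
SEQUENTIAL ε-axisymmetric door, itself a criterion INSIDE the Type-I class.
-/

noncomputable section

set_option linter.dupNamespace false

namespace Summit.NavierStokesRegularity.NavierStokesRegularity.Theorems.StableStrataDoorOneSliceAxiPropagation

open MeasureTheory Set Function Filter Topology TopologicalSpace Metric
open scoped RealInnerProductSpace NNReal ENNReal Topology
open Literature.Analysis Literature.Analysis.FluidPDE
open Summit.NavierStokesRegularity.NavierStokesRegularity.Theorems.LocalSineTubeDoorProfileAlignedWindowRigidityAncient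
open Summit.NavierStokesRegularity.NavierStokesRegularity.Theorems.StableStrataDoorOneSliceDefs

/-! ## One-slice uniqueness in the Oseen-ancient class -/

section OneSlice

variable {v w : ℝ → EuclideanSpace ℝ (Fin 3) → EuclideanSpace ℝ (Fin 3)}

/-- **FORWARD one-slice uniqueness** (bounded Oseen-mild uniqueness, tree `oseenMild_bounded_unique`): two
Oseen-ancient fields with the same slice at time `s` coincide at every time `t ∈ [s, 0)`. -/
theorem eq_forward
    (hcv : ContinuousOn (uncurry v) (Iio (0 : ℝ) ×ˢ univ))
    (hbv : ∀ δ : ℝ, 0 < δ → ∃ B : ℝ, ∀ t < -δ, ∀ y : EuclideanSpace ℝ (Fin 3), ‖v t y‖ ≤ B)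
    (hmv : ∀ s t : ℝ, s < t → t < 0 → ∀ y : EuclideanSpace ℝ (Fin 3),
      v t y = UnboundedOperators.heatExtension (v s) (t - s) y - oseenDuhamel 1 s v v t y)
    (hcw : ContinuousOn (uncurry w) (Iio (0 : ℝ) ×ˢ univ))
    (hbw : ∀ δ : ℝ, 0 < δ → ∃ B : ℝ, ∀ t < -δ, ∀ y : EuclideanSpace ℝ (Fin 3), ‖w t y‖ ≤ B)
    (hmw : ∀ s t : ℝ, s < t → t < 0 → ∀ y : EuclideanSpace ℝ (Fin 3),
      w t y = UnboundedOperators.heatExtension (w s) (t - s) y - oseenDuhamel 1 s w w t y)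
    {s : ℝ} (h : v s = w s) : ∀ t, s ≤ t → t < 0 → v t = w t := by
  intro t hst ht0
  rcases hst.eq_or_lt with rfl | hst'
  · exact h
  obtain ⟨T₂, htT₂, hT₂0⟩ : ∃ T₂ : ℝ, t < T₂ ∧ T₂ < 0 := ⟨t / 2, by linarith, by linarith⟩
  obtain ⟨Bv, hBv⟩ := hbv (-T₂) (by linarith)
  obtain ⟨Bw, hBw⟩ := hbw (-T₂) (by linarith)
  set M : ℝ := max (max Bv Bw) 0 with hM
  have hM0 : 0 ≤ M := le_max_right _ _
  have hvM : ∀ τ ∈ Ioo s T₂, ∀ y, ‖v τ y‖ ≤ M := fun τ hτ y =>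
    (hBv τ (by linarith [hτ.2]) y).trans ((le_max_left _ _).trans (le_max_left _ _))
  have hwM : ∀ τ ∈ Ioo s T₂, ∀ y, ‖w τ y‖ ≤ M := fun τ hτ y =>
    (hBw τ (by linarith [hτ.2]) y).trans ((le_max_right _ _).trans (le_max_left _ _))
  have hsub : Ioo s T₂ ×ˢ (univ : Set (EuclideanSpace ℝ (Fin 3))) ⊆ Iio 0 ×ˢ univ :=
    prod_mono (fun τ hτ => hτ.2.trans hT₂0) Subset.rfl
  have hvm : AEStronglyMeasurable (uncurry v) (volume.restrict (Ioo s T₂ ×ˢ univ)) :=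
    (hcv.mono hsub).aestronglyMeasurable (measurableSet_Ioo.prod MeasurableSet.univ)
  have hwm : AEStronglyMeasurable (uncurry w) (volume.restrict (Ioo s T₂ ×ˢ univ)) :=
    (hcw.mono hsub).aestronglyMeasurable (measurableSet_Ioo.prod MeasurableSet.univ)
  have hu : ∀ τ ∈ Ioo s T₂, v τ =ᵐ[volume] fun x =>
      UnboundedOperators.heatExtension (v s) (τ - s) x - oseenDuhamel 1 s v v τ x :=
    fun τ hτ => Eventually.of_forall fun x => hmv s τ hτ.1 (hτ.2.trans hT₂0) x
  have hu' : ∀ τ ∈ Ioo s T₂, w τ =ᵐ[volume] fun x =>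
      UnboundedOperators.heatExtension (v s) (τ - s) x - oseenDuhamel 1 s w w τ x := by
    intro τ hτ
    refine Eventually.of_forall fun x => ?_
    rw [h]
    exact hmw s τ hτ.1 (hτ.2.trans hT₂0) x
  have hae := oseenMild_bounded_unique
    (U := fun τ x => UnboundedOperators.heatExtension (v s) (τ - s) x)
    one_pos hM0 hvm hwm hvM hwM hu hu'
  have ht : t ∈ Ioo s T₂ := ⟨hst', htT₂⟩
  exact ((continuous_slice hcv ht0).ae_eq_iff_eq volume (continuous_slice hcw ht0)).1 (hae t ht)

/-- **BACKWARD one-slice uniqueness** (joint real-analyticity `analyticOnNhd_uncurry` + the identity theorem on the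
connected interval `(−∞,0)`): if two Oseen-ancient fields coincide at every time of `[s, 0)`, `s < 0`, they coincide
at every time `t < 0`. -/
theorem eq_backward
    (hcv : ContinuousOn (uncurry v) (Iio (0 : ℝ) ×ˢ univ))
    (hbv : ∀ δ : ℝ, 0 < δ → ∃ B : ℝ, ∀ t < -δ, ∀ y : EuclideanSpace ℝ (Fin 3), ‖v t y‖ ≤ B)
    (hmv : ∀ s t : ℝ, s < t → t < 0 → ∀ y : EuclideanSpace ℝ (Fin 3),
      v t y = UnboundedOperators.heatExtension (v s) (t - s) y - oseenDuhamel 1 s v v t y)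
    (hcw : ContinuousOn (uncurry w) (Iio (0 : ℝ) ×ˢ univ))
    (hbw : ∀ δ : ℝ, 0 < δ → ∃ B : ℝ, ∀ t < -δ, ∀ y : EuclideanSpace ℝ (Fin 3), ‖w t y‖ ≤ B)
    (hmw : ∀ s t : ℝ, s < t → t < 0 → ∀ y : EuclideanSpace ℝ (Fin 3),
      w t y = UnboundedOperators.heatExtension (w s) (t - s) y - oseenDuhamel 1 s w w t y)
    {s : ℝ} (hs : s < 0) (h : ∀ t, s ≤ t → t < 0 → v t = w t) : ∀ t < 0, v t = w t := by
  intro t ht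
  funext y
  have hg : AnalyticOnNhd ℝ (fun τ => v τ y - w τ y) (Iio 0) := by
    intro τ hτ
    have h1 : AnalyticAt ℝ (uncurry v) (τ, y) :=
      analyticOnNhd_uncurry hcv hbv hmv _ (mem_prod.2 ⟨hτ, mem_univ _⟩)
    have h2 : AnalyticAt ℝ (uncurry w) (τ, y) :=
      analyticOnNhd_uncurry hcw hbw hmw _ (mem_prod.2 ⟨hτ, mem_univ _⟩)
    have hι : AnalyticAt ℝ (fun σ : ℝ => (σ, y)) τ := analyticAt_id.prod analyticAt_const
    exact (h1.comp_of_eq hι rfl).sub (h2.comp_of_eq hι rfl)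
  have hs2 : s / 2 ∈ Iio (0 : ℝ) := by
    simp only [mem_Iio]
    linarith
  have hev : (fun τ => v τ y - w τ y) =ᶠ[𝓝 (s / 2)] 0 := by
    filter_upwards [isOpen_Ioo.mem_nhds (show s / 2 ∈ Ioo s 0 from ⟨by linarith, by linarith⟩)] with τ hτ
    simp only [Pi.zero_apply, sub_eq_zero]
    exact congrFun (h τ hτ.1.le hτ.2) y
  have := hg.eqOn_zero_of_preconnected_of_eventuallyEq_zero isPreconnected_Iio hs2 hev ht
  simpa [sub_eq_zero] using this

/-- **ONE-SLICE UNIQUENESS in the Oseen-ancient class**: two fields that are continuous on `(−∞,0) × ℝ³`, bounded on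
every `(−∞,−δ) × ℝ³`, satisfy the Oseen–Duhamel identity between any two negative times, and agree at ONE time
`s < 0`, agree at every time `t < 0`. -/
theorem eq_of_eq_slice
    (hcv : ContinuousOn (uncurry v) (Iio (0 : ℝ) ×ˢ univ))
    (hbv : ∀ δ : ℝ, 0 < δ → ∃ B : ℝ, ∀ t < -δ, ∀ y : EuclideanSpace ℝ (Fin 3), ‖v t y‖ ≤ B)
    (hmv : ∀ s t : ℝ, s < t → t < 0 → ∀ y : EuclideanSpace ℝ (Fin 3),
      v t y = UnboundedOperators.heatExtension (v s) (t - s) y - oseenDuhamel 1 s v v t y)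
    (hcw : ContinuousOn (uncurry w) (Iio (0 : ℝ) ×ˢ univ))
    (hbw : ∀ δ : ℝ, 0 < δ → ∃ B : ℝ, ∀ t < -δ, ∀ y : EuclideanSpace ℝ (Fin 3), ‖w t y‖ ≤ B)
    (hmw : ∀ s t : ℝ, s < t → t < 0 → ∀ y : EuclideanSpace ℝ (Fin 3),
      w t y = UnboundedOperators.heatExtension (w s) (t - s) y - oseenDuhamel 1 s w w t y)
    {s : ℝ} (hs : s < 0) (h : v s = w s) : ∀ t < 0, v t = w t :=
  eq_backward hcv hbv hmv hcw hbw hmw hs (eq_forward hcv hbv hmv hcw hbw hmw h)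

end OneSlice

/-! ## Classical Type-I solutions on the past are Oseen-ancient -/

/-- A classical Type-I(`D`) solution on `(−∞,0) × ℝ³` (`ν = 1`, `f = 0`) is Oseen-ancient: continuous on the open slab,
bounded by `D/√δ` on `(−∞,−δ)`, and Oseen-mild between any two negative times (KNSS 2009 Thm 6.1 mild gauge, tree
`mild_eq_of_classical_typeI`). -/
theorem oseenAncient_of_classical_typeI {D : ℝ} {V : ℝ → EuclideanSpace ℝ (Fin 3) → EuclideanSpace ℝ (Fin 3)}
    {q : ℝ → EuclideanSpace ℝ (Fin 3) → ℝ} (hcl : IsClassicalNSSolutionOn (Iio 0) 1 0 V q) (hdec : HasTypeIDecay D V) :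
    ContinuousOn (uncurry V) (Iio (0 : ℝ) ×ˢ univ) ∧
    (∀ δ : ℝ, 0 < δ → ∃ B : ℝ, ∀ t < -δ, ∀ y : EuclideanSpace ℝ (Fin 3), ‖V t y‖ ≤ B) ∧
    (∀ s t : ℝ, s < t → t < 0 → ∀ y : EuclideanSpace ℝ (Fin 3),
      V t y = UnboundedOperators.heatExtension (V s) (t - s) y - oseenDuhamel 1 s V V t y) := by
  refine ⟨hcl.smooth_velocity.continuousOn,
    bdd_of_hasTypeITimeDecay (hdec.hasTypeITimeDecay (nonneg_of_hasTypeIDecay hdec)), fun s t hst ht y => ?_⟩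
  rw [← heatFlow_of_pos _ (sub_pos.2 hst)]
  exact PolyhedralDssProfileExists.Birth.mild_eq_of_classical_typeI hcl hdec hst ht y

/-- **One-slice uniqueness for classical Type-I solutions on the past**: two classical solutions (`ν = 1`, `f = 0`) on
`(−∞,0) × ℝ³` with Type-I decay that agree at one time `s₀ < 0` agree at every time. -/
theorem eq_of_eq_slice_classical {D D' : ℝ} {V V' : ℝ → EuclideanSpace ℝ (Fin 3) → EuclideanSpace ℝ (Fin 3)}
    {q q' : ℝ → EuclideanSpace ℝ (Fin 3) → ℝ}
    (hcl : IsClassicalNSSolutionOn (Iio 0) 1 0 V q) (hdec : HasTypeIDecay D V)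
    (hcl' : IsClassicalNSSolutionOn (Iio 0) 1 0 V' q') (hdec' : HasTypeIDecay D' V')
    {s₀ : ℝ} (hs₀ : s₀ < 0) (h : V s₀ = V' s₀) : ∀ τ < 0, V τ = V' τ := by
  obtain ⟨hc, hb, hm⟩ := oseenAncient_of_classical_typeI hcl hdec
  obtain ⟨hc', hb', hm'⟩ := oseenAncient_of_classical_typeI hcl' hdec'
  exact eq_of_eq_slice hc hb hm hc' hb' hm' hs₀ h

/-! ## I2b PROVED -/

/-- **I2b · ONE-SLICE PROPAGATION OF AXISYMMETRY** (text `StableStrataDoorOneSliceDefs.OneSliceAxiPropagation` VERBATIM),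
for every axis isometry `A` and every decay constant `D`.  Conjugate by the linear isometry `L = A ∘ R_θ ∘ A⁻¹`:
`V^L(t,x) = L V(t, L⁻¹x)` is again a classical Type-I(`D`) solution on the past, axisymmetry about `A e₃` at `s₀` is
`V^L(s₀) = V(s₀)`, and one-slice uniqueness gives `V^L(τ) = V(τ)` for all `τ < 0`, i.e. axisymmetry at every time. -/
theorem oneSliceAxiPropagation_holds (A : EuclideanSpace ℝ (Fin 3) ≃ₗᵢ[ℝ] EuclideanSpace ℝ (Fin 3)) (D : ℝ) :
    OneSliceAxiPropagation A D := by
  intro V q hcl hdec s₀ hs₀ haxi τ hτ θ z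
  -- the conjugating isometry `L = A ∘ R_θ ∘ A⁻¹`
  set L : EuclideanSpace ℝ (Fin 3) ≃ₗᵢ[ℝ] EuclideanSpace ℝ (Fin 3) := (A.symm.trans (rotZLIE θ)).trans A with hL
  have hLapply : ∀ y, L y = A (rotZ θ (A.symm y)) := fun y => rfl
  -- the conjugate solution
  have hclL : IsClassicalNSSolutionOn (Iio 0) 1 0 (fun t x => L (V t (L.symm x))) (fun t x => q t (L.symm x)) := by
    have h1 := hcl.conj_linearIsometryEquiv L (uniqueDiffOn_Iio 0)
    exact h1.congr_force (g := 0) (fun t _ x => by simp)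
  have hdecL : HasTypeIDecay D (fun t x => L (V t (L.symm x))) := hdec.conj_linearIsometryEquiv L
  -- axisymmetry at `s₀` = the conjugate has the same slice at `s₀`
  have hslice : (fun t x => L (V t (L.symm x))) s₀ = V s₀ := by
    funext x
    show L (V s₀ (L.symm x)) = V s₀ x
    have key : ∀ y, L (V s₀ y) = V s₀ (L y) := by
      intro y
      have h1 : A.symm (V s₀ (A (rotZ θ (A.symm y)))) = rotZ θ (A.symm (V s₀ (A (A.symm y)))) :=
        haxi θ (A.symm y)
      rw [LinearIsometryEquiv.apply_symm_apply] at h1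
      rw [hLapply, hLapply, ← h1, LinearIsometryEquiv.apply_symm_apply]
    rw [key, LinearIsometryEquiv.apply_symm_apply]
  -- one-slice uniqueness
  have heq := eq_of_eq_slice_classical hclL hdecL hcl hdec hs₀ hslice τ hτ
  -- read off axisymmetry at time `τ`
  have hx := congrFun heq (L (A z))
  -- `hx : L (V τ (L.symm (L (A z)))) = V τ (L (A z))`
  rw [LinearIsometryEquiv.symm_apply_apply, hLapply, hLapply, LinearIsometryEquiv.symm_apply_apply] at hx
  -- `hx : A (rotZ θ (A.symm (V τ (A z)))) = V τ (A (rotZ θ z))`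
  show A.symm (V τ (A (rotZ θ z))) = rotZ θ (A.symm (V τ (A z)))
  rw [← hx, LinearIsometryEquiv.symm_apply_apply]

end Summit.NavierStokesRegularity.NavierStokesRegularity.Theorems.StableStrataDoorOneSliceAxiPropagation
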